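import Mathlib

/-!
# MatrixMultiplication / AutomaticSTPPDesigns — `SmallScalesSuffice`, pumping-down toolkit

Route `AutomaticSTPPDesigns`, support item `SmallScalesSuffice` (stmt-MatrixMultiplication-7360).
This file holds the abstract part of the proof:

* `smallScales_shorten` — pumping down: a "violation" (a list read by a right-congruent state
  function with finitely many values, whose base-`p` signed digit sum vanishes modulo `p ^ length`,
  with a pointwise side condition and an existential flag) of length `≥ 10 · #states` shortens to
  a violation of smaller length (pigeonhole on the prefixes, tracking state, carry `∈ [-2, 2]` and
  flag, then deletion of the segment between two prefixes with equal data);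
* `smallScales_ofDigits_ofFn`, `smallScales_digits_eq_of_cast_eq`, `smallScales_ofFn_get_comp` —
  bookkeeping between digit strings `Fin k → Fin p`, their values `∑ j, a j * p ^ j`
  (`= finFunctionFinEquiv`, `= Nat.ofDigits` of the list of digits) and lists.
-/

-- the tree's namespace `Summit.MatrixMultiplication.MatrixMultiplication.…` repeats a component by
-- design
set_option linter.dupNamespace false

namespace Summit.MatrixMultiplication.MatrixMultiplication.Theorems

/-! ## Pumping down, abstractly -/

/-- **Pumping down** for a "violation" read by a right-congruent state function `q` with finitely
many values, a base-`p` signed digit sum `S` (additive under concatenation, `|S l| < 3 p^{|l|}`)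
that must vanish modulo `p^{|l|}`, a pointwise side condition `good` and an existential flag `bad`:
a violation of length `≥ 10 |Q|` shortens to one of smaller length with the same `q`-value.
[folklore] -/
theorem smallScales_shorten {Λ Q : Type*} [Fintype Q] (q : List Λ → Q)
    (hq : ∀ l₁ l₁' l₂ : List Λ, q l₁ = q l₁' → q (l₁ ++ l₂) = q (l₁' ++ l₂))
    (p : ℕ) (hp : 2 ≤ p) (S : List Λ → ℤ)
    (hS : ∀ l₁ l₂ : List Λ, S (l₁ ++ l₂) = S l₁ + (p : ℤ) ^ l₁.length * S l₂)
    (hSb : ∀ l : List Λ, |S l| < 3 * (p : ℤ) ^ l.length)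
    (good bad : Λ → Prop) (l : List Λ) (hlen : 10 * Fintype.card Q ≤ l.length)
    (hdiv : (p : ℤ) ^ l.length ∣ S l) (hgood : ∀ x ∈ l, good x) (hbad : ∃ x ∈ l, bad x) :
    ∃ l' : List Λ, l'.length < l.length ∧ q l' = q l ∧ (p : ℤ) ^ l'.length ∣ S l' ∧
      (∀ x ∈ l', good x) ∧ ∃ x ∈ l', bad x := by
  classical
  have hp0 : (0 : ℤ) < p := by exact_mod_cast (by omega : 0 < p)
  -- every prefix sum is divisible by the corresponding power of `p`
  have hpre : ∀ n ≤ l.length, (p : ℤ) ^ n ∣ S (l.take n) := by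
    intro n hn
    have h1 : S l = S (l.take n) + (p : ℤ) ^ n * S (l.drop n) := by
      conv_lhs => rw [← List.take_append_drop n l]
      rw [hS, List.length_take, min_eq_left hn]
    have h2 : (p : ℤ) ^ n ∣ S l := (pow_dvd_pow _ hn).trans hdiv
    have h3 : S (l.take n) = S l - (p : ℤ) ^ n * S (l.drop n) := by rw [h1]; ring
    rw [h3]
    exact dvd_sub h2 (dvd_mul_right _ _)
  -- the carry after `n` letters
  set c : ℕ → ℤ := fun n => S (l.take n) / (p : ℤ) ^ n with hc
  have hcS : ∀ n ≤ l.length, S (l.take n) = (p : ℤ) ^ n * c n := fun n hn =>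
    (Int.mul_ediv_cancel' (hpre n hn)).symm
  have hcb : ∀ n ≤ l.length, c n ∈ Finset.Icc (-2 : ℤ) 2 := by
    intro n hn
    have hb := hSb (l.take n)
    rw [List.length_take, min_eq_left hn, hcS n hn, abs_mul, abs_of_pos (pow_pos hp0 n)] at hb
    have : |c n| < 3 := lt_of_mul_lt_mul_left (by linarith) (pow_pos hp0 n).le
    rw [abs_lt] at this
    rw [Finset.mem_Icc]; omega
  -- pigeonhole on the `l.length + 1` prefixes
  set f : ℕ → Q × ℤ × Bool := fun n => (q (l.take n), c n, decide (∃ x ∈ l.take n, bad x)) with hf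
  have hmaps : Set.MapsTo f ↑(Finset.range (l.length + 1))
      ↑((Finset.univ : Finset Q) ×ˢ (Finset.Icc (-2 : ℤ) 2 ×ˢ (Finset.univ : Finset Bool))) := by
    intro n hn
    rw [Finset.coe_range, Set.mem_Iio] at hn
    simp only [Finset.coe_product, Finset.coe_univ, Set.mem_prod, Set.mem_univ, true_and, and_true,
      Finset.mem_coe, hf]
    exact hcb n (by omega)
  have hcard :
      ((Finset.univ : Finset Q) ×ˢ (Finset.Icc (-2 : ℤ) 2 ×ˢ (Finset.univ : Finset Bool))).card <
        (Finset.range (l.length + 1)).card := by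
    have h5 : (Finset.Icc (-2 : ℤ) 2).card = 5 := rfl
    simp only [Finset.card_product, Finset.card_univ, h5, Fintype.card_bool, Finset.card_range]
    omega
  obtain ⟨i₀, hi₀, j₀, hj₀, hne, hfij⟩ := Finset.exists_ne_map_eq_of_card_lt_of_maps_to hcard hmaps
  rw [Finset.mem_range] at hi₀ hj₀
  -- order the two prefixes
  obtain ⟨i, j, hij, hj, hfeq⟩ : ∃ i j : ℕ, i < j ∧ j ≤ l.length ∧ f i = f j := by
    rcases Nat.lt_or_gt_of_ne hne with h | h
    · exact ⟨i₀, j₀, h, by omega, hfij⟩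
    · exact ⟨j₀, i₀, h, by omega, hfij.symm⟩
  have hi : i ≤ l.length := by omega
  simp only [hf, Prod.mk.injEq] at hfeq
  obtain ⟨hqij, hcij, hflag⟩ := hfeq
  -- delete the segment `[i, j)`
  refine ⟨l.take i ++ l.drop j, ?_, ?_, ?_, ?_, ?_⟩
  · simp only [List.length_append, List.length_take, List.length_drop, min_eq_left hi]
    omega
  · rw [hq _ _ (l.drop j) hqij, List.take_append_drop]
  · have hlen' : (l.take i ++ l.drop j).length = i + (l.length - j) := by
      simp only [List.length_append, List.length_take, List.length_drop, min_eq_left hi]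
    have hT : S l = (p : ℤ) ^ j * (c j + S (l.drop j)) := by
      conv_lhs => rw [← List.take_append_drop j l]
      rw [hS, List.length_take, min_eq_left hj, hcS j hj]
      ring
    have hT' : S (l.take i ++ l.drop j) = (p : ℤ) ^ i * (c j + S (l.drop j)) := by
      rw [hS, List.length_take, min_eq_left hi, hcS i hi, hcij]
      ring
    have hk : l.length = j + (l.length - j) := by omega
    rw [hk, pow_add, hT] at hdiv
    have hd : (p : ℤ) ^ (l.length - j) ∣ c j + S (l.drop j) :=
      (mul_dvd_mul_iff_left (pow_ne_zero j hp0.ne')).mp hdiv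
    rw [hlen', hT', pow_add]
    exact mul_dvd_mul_left _ hd
  · intro x hx
    rw [List.mem_append] at hx
    rcases hx with hx | hx
    · exact hgood x (List.mem_of_mem_take hx)
    · exact hgood x (List.mem_of_mem_drop hx)
  · by_cases hfl : ∃ x ∈ l.take j, bad x
    · have hfl' : ∃ x ∈ l.take i, bad x := by
        have := hflag
        simp only [decide_eq_decide] at this
        exact this.mpr hfl
      obtain ⟨x, hx, hbx⟩ := hfl'
      exact ⟨x, List.mem_append.mpr (Or.inl hx), hbx⟩
    · obtain ⟨x, hx, hbx⟩ := hbad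
      rw [← List.take_append_drop j l, List.mem_append] at hx
      rcases hx with hx | hx
      · exact absurd ⟨x, hx, hbx⟩ hfl
      · exact ⟨x, List.mem_append.mpr (Or.inr hx), hbx⟩

/-! ## Base-`p` values of digit strings -/

/-- The little-endian base-`p` value of a digit string `a : Fin k → ℕ`, written as the sum
`∑ j, a j * p ^ j`, is `Nat.ofDigits p (List.ofFn a)`. [folklore] -/
theorem smallScales_ofDigits_ofFn (p : ℕ) :
    ∀ (k : ℕ) (a : Fin k → ℕ), Nat.ofDigits p (List.ofFn a) = ∑ j : Fin k, a j * p ^ (j : ℕ)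
  | 0, a => by simp
  | k + 1, a => by
    rw [List.ofFn_succ, Nat.ofDigits_cons, smallScales_ofDigits_ofFn p k, Fin.sum_univ_succ,
      Finset.mul_sum]
    simp only [Fin.val_zero, pow_zero, mul_one, Fin.val_succ, pow_succ]
    congr 1
    refine Finset.sum_congr rfl fun j _ => ?_
    ring

/-- Digit strings of length `k` are determined by their base-`p` value modulo `p ^ k`
(the value map is `finFunctionFinEquiv`, a bijection onto `Fin (p ^ k)`). [folklore] -/
theorem smallScales_digits_eq_of_cast_eq {p k : ℕ} (a a' : Fin k → Fin p)
    (h : ((∑ j : Fin k, (a j : ℕ) * p ^ (j : ℕ) : ℕ) : ZMod (p ^ k)) =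
      ((∑ j : Fin k, (a' j : ℕ) * p ^ (j : ℕ) : ℕ) : ZMod (p ^ k))) : a = a' := by
  have ha : ∑ j : Fin k, (a j : ℕ) * p ^ (j : ℕ) < p ^ k := (finFunctionFinEquiv a).isLt
  have ha' : ∑ j : Fin k, (a' j : ℕ) * p ^ (j : ℕ) < p ^ k := (finFunctionFinEquiv a').isLt
  rw [ZMod.natCast_eq_natCast_iff', Nat.mod_eq_of_lt ha, Nat.mod_eq_of_lt ha'] at h
  exact finFunctionFinEquiv.injective (Fin.ext h)

/-- `List.ofFn` of a function read off a list through `List.get` is `List.map`. [folklore] -/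
theorem smallScales_ofFn_get_comp {α β : Type*} (l : List α) (f : α → β) :
    List.ofFn (fun j : Fin l.length => f (l.get j)) = l.map f := by
  change List.ofFn (f ∘ l.get) = _
  rw [← List.map_ofFn, List.ofFn_get]

end Summit.MatrixMultiplication.MatrixMultiplication.Theorems
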